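import Mathlib
import HarnessLib
import Literature.Analysis.FluidPDE.RieszKernelBounds
import Literature.Analysis.Potential.NewtonFarField

/-!
# Route `QuarterLogPincer`, crux `TypeIQuantSubcubicExp` (stmt-NavierStokesRegularity-24077), line `quiet_collar` — towards QP2
# `stub_cutPair`, module M2 (log-sharp sup bound of the shell potential): THE SLAB VOLUME LEMMA

The data error of the cut pair is `w = ∇Δ⁻¹(∇χ·v₀)`, a Newtonian gradient potential of a source living on the spherical
shell `A = {r ≤ |y| ≤ r + L}` (the quiet collar).  Its log-sharp sup bound `|w(x)| ≲ sup|∇χ·v₀| · L · (1 + log(r/L))` rests on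
ONE geometric fact: a ball of radius `ρ ≤ r/4` meets the shell in volume `O(L ρ²)` (a shell of thickness `L` is locally a slab),
not `O(ρ³)`.  This file proves it: `volume_shell_inter_ball_le` — `|A ∩ B(x,ρ)| ≤ 24·L·ρ²` for `0 < 4ρ ≤ r` — by a reflection
taking `x` to the third axis (`Submodule.reflection_sub`), the product structure of Lebesgue measure in Euclidean coordinates
(`PiLp.volume_preserving_ofLp`, `measurePreserving_piFinSuccAbove`, `Measure.prod_apply_symm`) and the one-dimensional band
estimate `volume_sqBand_le` (`|{τ : r² − c ≤ τ² ≤ (r+L)² − c}| ≤ 6L` for `9c ≤ 5r²`).  r-INDEPENDENT groundwork for QP2 (typed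
audit, pub-ns-dss bus 2026-08-29T01:10Z).  HONEST FRAME: elementary measure geometry; nothing here bears on 24077, W7 or
Navier–Stokes regularity (OPEN).  Helper of the pub-ns-dss typer (g36), `--supports 24077`.
-/

noncomputable section

set_option linter.dupNamespace false

namespace Summit.NavierStokesRegularity.NavierStokesRegularity.Cruxes.TypeIQuantSubcubicExp.QuietCollar

open MeasureTheory Set Function Filter Real Metric
open scoped ENNReal NNReal Topology
open Literature.Analysis.FluidPDE.RieszKernel (powKer powKer_apply powKer_le_const measurable_powKer_sub powKer_sub_comm)


/-- Coordinates of `y − a·e₂`. [folklore] -/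
theorem sub_smul_single_apply (y : EuclideanSpace ℝ (Fin 3)) (a : ℝ) (j : Fin 3) :
    (y - a • EuclideanSpace.single (2 : Fin 3) (1 : ℝ)) j = y j - a * (if j = 2 then 1 else 0) := by
  simp [PiLp.single_apply]


/-- **1-D band**: for `0 < r`, `0 < L`, `9c ≤ 5r²`, the set `{τ : r² − c ≤ τ² ≤ (r+L)² − c}` (two intervals
`±[√(r²−c), √((r+L)²−c)]`) has measure `≤ 6L` (each has length `L(2r+L)/(√((r+L)²−c) + √(r²−c)) ≤ 3L`). [folklore] -/
theorem volume_sqBand_le {r L c : ℝ} (hr : 0 < r) (hL : 0 < L) (hc : 9 * c ≤ 5 * r ^ 2) :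
    volume {τ : ℝ | r ^ 2 - c ≤ τ ^ 2 ∧ τ ^ 2 ≤ (r + L) ^ 2 - c} ≤ ENNReal.ofReal (6 * L) := by
  have hαsq : 0 ≤ r ^ 2 - c := by nlinarith
  have hβsq : 0 ≤ (r + L) ^ 2 - c := by nlinarith
  obtain ⟨α, hα⟩ : ∃ α : ℝ, α = Real.sqrt (r ^ 2 - c) := ⟨_, rfl⟩
  obtain ⟨β, hβ⟩ : ∃ β : ℝ, β = Real.sqrt ((r + L) ^ 2 - c) := ⟨_, rfl⟩
  have hα0 : 0 ≤ α := by rw [hα]; exact Real.sqrt_nonneg _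
  have hβ0 : 0 ≤ β := hα0.trans (by rw [hα, hβ]; exact Real.sqrt_le_sqrt (by nlinarith))
  have hα2 : α ^ 2 = r ^ 2 - c := by rw [hα, Real.sq_sqrt hαsq]
  have hβ2 : β ^ 2 = (r + L) ^ 2 - c := by rw [hβ, Real.sq_sqrt hβsq]
  -- `β ≥ (2r+L)/3`, whence `β − α ≤ 3L`
  have hβlow : (2 * r + L) / 3 ≤ β := by
    rw [hβ]
    refine Real.le_sqrt_of_sq_le ?_
    nlinarith
  have hαβ : α ≤ β := by rw [hα, hβ]; exact Real.sqrt_le_sqrt (by nlinarith)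
  have hdiff : β - α ≤ 3 * L := by
    have hprod : (β - α) * (β + α) = L * (2 * r + L) := by nlinarith
    have hsum : (2 * r + L) / 3 ≤ β + α := by linarith
    have hsum0 : 0 < β + α := by
      have : 0 < (2 * r + L) / 3 := by positivity
      linarith
    have h1 : β - α = L * (2 * r + L) / (β + α) := by rw [eq_div_iff hsum0.ne']; exact hprod
    rw [h1, div_le_iff₀ hsum0]
    nlinarith
  -- the set lies in `[-β,-α] ∪ [α, β]`
  have hsub : {τ : ℝ | r ^ 2 - c ≤ τ ^ 2 ∧ τ ^ 2 ≤ (r + L) ^ 2 - c} ⊆ Set.Icc (-β) (-α) ∪ Set.Icc α β := by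
    rintro τ ⟨h1, h2⟩
    have hlo : α ≤ |τ| := by
      rw [← hα2] at h1
      have := sq_le_sq.1 h1
      rwa [abs_of_nonneg hα0] at this
    have hhi : |τ| ≤ β := by
      rw [← hβ2] at h2
      have := sq_le_sq.1 h2
      rwa [abs_of_nonneg hβ0] at this
    rcases le_or_gt 0 τ with hτ | hτ
    · right; rw [abs_of_nonneg hτ] at hlo hhi; exact ⟨hlo, hhi⟩
    · left; rw [abs_of_neg hτ] at hlo hhi; exact ⟨by linarith, by linarith⟩
  calc volume {τ : ℝ | r ^ 2 - c ≤ τ ^ 2 ∧ τ ^ 2 ≤ (r + L) ^ 2 - c}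
      ≤ volume (Set.Icc (-β) (-α) ∪ Set.Icc α β) := measure_mono hsub
    _ ≤ volume (Set.Icc (-β) (-α)) + volume (Set.Icc α β) := measure_union_le _ _
    _ = ENNReal.ofReal (β - α) + ENNReal.ofReal (β - α) := by
        rw [Real.volume_Icc, Real.volume_Icc]; ring_nf
    _ ≤ ENNReal.ofReal (3 * L) + ENNReal.ofReal (3 * L) := by gcongr
    _ = ENNReal.ofReal (6 * L) := by rw [← ENNReal.ofReal_add (by positivity) (by positivity)]; ring_nf


/-- **SLAB VOLUME LEMMA**: a ball of radius `ρ` with `0 < 4ρ ≤ r` meets the spherical shell `{r ≤ |y| ≤ r + L}` in volume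
`≤ 24·L·ρ²` (reflect `x` to the third axis; in Euclidean coordinates the intersection lies over the square `|y₀|,|y₁| < ρ` with
third coordinate in the band `r² − (y₀²+y₁²) ≤ y₂² ≤ (r+L)² − (y₀²+y₁²)` of length `≤ 6L`). [folklore] -/
theorem volume_shell_inter_ball_le {r L ρ : ℝ} (hr : 0 < r) (hL : 0 < L) (hρ : 0 < ρ) (hρr : 4 * ρ ≤ r)
    (x : EuclideanSpace ℝ (Fin 3)) :
    volume ({y : EuclideanSpace ℝ (Fin 3) | r ≤ ‖y‖ ∧ ‖y‖ ≤ r + L} ∩ Metric.ball x ρ) ≤ ENNReal.ofReal (24 * L * ρ ^ 2) := by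
  -- Euclidean coordinates (as `Literature.Algebra.EuclideanLattices.norm_sq_fin_three`, not worth the import)
  have norm_sq_eq_coord : ∀ y : EuclideanSpace ℝ (Fin 3), ‖y‖ ^ 2 = y 0 ^ 2 + y 1 ^ 2 + y 2 ^ 2 := fun y => by
    rw [EuclideanSpace.norm_eq, Real.sq_sqrt (by positivity), Fin.sum_univ_three]
    simp [Real.norm_eq_abs, sq_abs]
  -- the reflection taking `x` to `‖x‖ e₂`
  obtain ⟨e, he⟩ : ∃ e : EuclideanSpace ℝ (Fin 3), e = EuclideanSpace.single (2 : Fin 3) (1 : ℝ) := ⟨_, rfl⟩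
  have he1 : ‖e‖ = 1 := by
    rw [he, show (EuclideanSpace.single (2 : Fin 3) (1 : ℝ) : EuclideanSpace ℝ (Fin 3)) = PiLp.single 2 2 1 from rfl,
      PiLp.norm_single, norm_one]
  have hxe : ‖x‖ = ‖(‖x‖ • e)‖ := by rw [norm_smul, norm_norm, he1, mul_one]
  obtain ⟨Φ, hΦ⟩ : ∃ Φ : EuclideanSpace ℝ (Fin 3) ≃ₗᵢ[ℝ] EuclideanSpace ℝ (Fin 3), Φ x = ‖x‖ • e :=
    ⟨_, Submodule.reflection_sub hxe⟩
  -- Euclidean coordinates `y ↦ (y₂, (y₀, y₁))` after the reflection: a measure-preserving map to `ℝ × ℝ²`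
  obtain ⟨Ψ, hΨ⟩ : ∃ Ψ : EuclideanSpace ℝ (Fin 3) → ℝ × (Fin 2 → ℝ),
      Ψ = fun y => (MeasurableEquiv.piFinSuccAbove (fun _ : Fin 3 => ℝ) 2) (WithLp.ofLp (Φ y)) := ⟨_, rfl⟩
  have hΨmp : MeasurePreserving Ψ volume ((volume : Measure ℝ).prod (volume : Measure (Fin 2 → ℝ))) := by
    rw [hΨ]
    exact (MeasureTheory.measurePreserving_piFinSuccAbove (fun _ : Fin 3 => (volume : Measure ℝ)) 2).comp
      ((PiLp.volume_preserving_ofLp (Fin 3)).comp Φ.measurePreserving)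
  have hΨ1 : ∀ y, (Ψ y).1 = (Φ y) 2 := fun y => by rw [hΨ]; rfl
  have hΨ20 : ∀ y, (Ψ y).2 0 = (Φ y) 0 := fun y => by rw [hΨ]; rfl
  have hΨ21 : ∀ y, (Ψ y).2 1 = (Φ y) 1 := fun y => by rw [hΨ]; rfl
  -- the target set in coordinates
  obtain ⟨T, hT⟩ : ∃ T : Set (ℝ × (Fin 2 → ℝ)), T = {p | (|p.2 0| < ρ ∧ |p.2 1| < ρ) ∧
      (r ^ 2 - (p.2 0 ^ 2 + p.2 1 ^ 2) ≤ p.1 ^ 2 ∧ p.1 ^ 2 ≤ (r + L) ^ 2 - (p.2 0 ^ 2 + p.2 1 ^ 2))} := ⟨_, rfl⟩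
  have hc0 : Continuous fun p : ℝ × (Fin 2 → ℝ) => p.2 0 := (continuous_apply 0).comp continuous_snd
  have hc1 : Continuous fun p : ℝ × (Fin 2 → ℝ) => p.2 1 := (continuous_apply 1).comp continuous_snd
  have hcc : Continuous fun p : ℝ × (Fin 2 → ℝ) => p.2 0 ^ 2 + p.2 1 ^ 2 := (hc0.pow 2).add (hc1.pow 2)
  have hTm : MeasurableSet T := by
    rw [hT]
    refine (MeasurableSet.inter (measurableSet_lt hc0.abs.measurable measurable_const)
      (measurableSet_lt hc1.abs.measurable measurable_const)).inter
      (MeasurableSet.inter (measurableSet_le (measurable_const.sub hcc.measurable) (continuous_fst.pow 2).measurable)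
        (measurableSet_le (continuous_fst.pow 2).measurable (measurable_const.sub hcc.measurable)))
  -- the shell ∩ ball lies in the preimage of `T`
  have hsub : {y : EuclideanSpace ℝ (Fin 3) | r ≤ ‖y‖ ∧ ‖y‖ ≤ r + L} ∩ Metric.ball x ρ ⊆ Ψ ⁻¹' T := by
    rintro y ⟨⟨hy1, hy2⟩, hyx⟩
    rw [Metric.mem_ball, dist_eq_norm] at hyx
    have hn : ‖Φ y‖ = ‖y‖ := Φ.norm_map y
    have hd : ‖Φ y - ‖x‖ • e‖ = ‖y - x‖ := by rw [← hΦ, ← map_sub, Φ.norm_map]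
    have hsq := norm_sq_eq_coord (Φ y)
    have hdsq := norm_sq_eq_coord (Φ y - ‖x‖ • e)
    rw [he, sub_smul_single_apply, sub_smul_single_apply, sub_smul_single_apply] at hdsq
    simp only [Fin.isValue, Fin.reduceEq, ↓reduceIte, mul_zero, sub_zero, mul_one] at hdsq
    rw [← he] at hdsq
    have hdρ : ‖Φ y - ‖x‖ • e‖ ^ 2 < ρ ^ 2 := by
      rw [hd]; exact pow_lt_pow_left₀ hyx (norm_nonneg _) two_ne_zero
    have hr2 : r ^ 2 ≤ ‖Φ y‖ ^ 2 := by rw [hn]; exact pow_le_pow_left₀ hr.le hy1 2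
    have hrL2 : ‖Φ y‖ ^ 2 ≤ (r + L) ^ 2 := by rw [hn]; exact pow_le_pow_left₀ (norm_nonneg _) hy2 2
    rw [Set.mem_preimage, hT, Set.mem_setOf_eq, hΨ1, hΨ20, hΨ21]
    have h3 : 0 ≤ ((Φ y) 2 - ‖x‖) ^ 2 := sq_nonneg _
    exact ⟨⟨abs_lt_of_sq_lt_sq (by nlinarith [sq_nonneg ((Φ y) 1)]) hρ.le,
      abs_lt_of_sq_lt_sq (by nlinarith [sq_nonneg ((Φ y) 0)]) hρ.le⟩, by linarith, by linarith⟩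
  -- the measure of `T`: sections over the square have length `≤ 6L`
  have hsq : MeasurableSet (Set.pi Set.univ fun _ : Fin 2 => Set.Ioo (-ρ) ρ) :=
    MeasurableSet.univ_pi fun _ => measurableSet_Ioo
  have hsec : ∀ z : Fin 2 → ℝ, volume ((fun τ : ℝ => (τ, z)) ⁻¹' T) ≤
      (Set.pi Set.univ fun _ : Fin 2 => Set.Ioo (-ρ) ρ).indicator (fun _ => ENNReal.ofReal (6 * L)) z := by
    intro z
    by_cases hz : |z 0| < ρ ∧ |z 1| < ρ
    · have hzmem : z ∈ Set.pi Set.univ fun _ : Fin 2 => Set.Ioo (-ρ) ρ := by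
        intro i _
        fin_cases i
        · exact ⟨(abs_lt.1 hz.1).1, (abs_lt.1 hz.1).2⟩
        · exact ⟨(abs_lt.1 hz.2).1, (abs_lt.1 hz.2).2⟩
      rw [Set.indicator_of_mem hzmem]
      have hset : (fun τ : ℝ => (τ, z)) ⁻¹' T =
          {τ : ℝ | r ^ 2 - (z 0 ^ 2 + z 1 ^ 2) ≤ τ ^ 2 ∧ τ ^ 2 ≤ (r + L) ^ 2 - (z 0 ^ 2 + z 1 ^ 2)} := by
        ext τ; simp [hT, hz]
      rw [hset]
      have hz0 : z 0 ^ 2 < ρ ^ 2 := by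
        have := hz.1; rw [← sq_abs]; exact pow_lt_pow_left₀ this (abs_nonneg _) two_ne_zero
      have hz1 : z 1 ^ 2 < ρ ^ 2 := by
        have := hz.2; rw [← sq_abs]; exact pow_lt_pow_left₀ this (abs_nonneg _) two_ne_zero
      exact volume_sqBand_le hr hL (by nlinarith)
    · have hempty : (fun τ : ℝ => (τ, z)) ⁻¹' T = ∅ := by ext τ; simp [hT, hz]
      rw [hempty, measure_empty]; exact bot_le
  calc volume ({y : EuclideanSpace ℝ (Fin 3) | r ≤ ‖y‖ ∧ ‖y‖ ≤ r + L} ∩ Metric.ball x ρ)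
      ≤ volume (Ψ ⁻¹' T) := measure_mono hsub
    _ = ((volume : Measure ℝ).prod (volume : Measure (Fin 2 → ℝ))) T := hΨmp.measure_preimage hTm.nullMeasurableSet
    _ = ∫⁻ z, volume ((fun τ : ℝ => (τ, z)) ⁻¹' T) ∂(volume : Measure (Fin 2 → ℝ)) := Measure.prod_apply_symm hTm
    _ ≤ ∫⁻ z, (Set.pi Set.univ fun _ : Fin 2 => Set.Ioo (-ρ) ρ).indicator (fun _ => ENNReal.ofReal (6 * L)) z
          ∂(volume : Measure (Fin 2 → ℝ)) := lintegral_mono hsec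
    _ = ENNReal.ofReal (6 * L) * volume (Set.pi Set.univ fun _ : Fin 2 => Set.Ioo (-ρ) ρ) :=
          lintegral_indicator_const hsq _
    _ = ENNReal.ofReal (6 * L) * ENNReal.ofReal (2 * ρ) ^ 2 := by
          rw [volume_pi_pi]
          simp only [Real.volume_Ioo, Finset.prod_const, Finset.card_univ, Fintype.card_fin]
          rw [show ρ - -ρ = 2 * ρ by ring]
    _ = ENNReal.ofReal (24 * L * ρ ^ 2) := by
          rw [← ENNReal.ofReal_pow (by positivity), ← ENNReal.ofReal_mul (by positivity)]
          ring_nf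


/-- Volume of the shell `{r ≤ |y| ≤ r + L}`: `≤ |B₁|·((r+L)³ − r³)`. [folklore] -/
theorem volume_shell_le {r L : ℝ} (hr : 0 < r) (hL : 0 < L) :
    volume {y : EuclideanSpace ℝ (Fin 3) | r ≤ ‖y‖ ∧ ‖y‖ ≤ r + L} ≤
      ENNReal.ofReal ((r + L) ^ 3 - r ^ 3) * volume (Metric.ball (0 : EuclideanSpace ℝ (Fin 3)) 1) := by
  have hsub : {y : EuclideanSpace ℝ (Fin 3) | r ≤ ‖y‖ ∧ ‖y‖ ≤ r + L} ⊆
      Metric.closedBall (0 : EuclideanSpace ℝ (Fin 3)) (r + L) \ Metric.ball 0 r := by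
    rintro y ⟨h1, h2⟩
    exact ⟨mem_closedBall_zero_iff.2 h2, fun h => by rw [mem_ball_zero_iff] at h; linarith⟩
  refine (measure_mono hsub).trans ?_
  rw [measure_sdiff (Metric.ball_subset_closedBall.trans (Metric.closedBall_subset_closedBall (by linarith)))
    measurableSet_ball.nullMeasurableSet measure_ball_lt_top.ne,
    Measure.addHaar_closedBall _ _ (by linarith), Measure.addHaar_ball_of_pos _ _ hr, finrank_euclideanSpace_fin,
    ← ENNReal.sub_mul (fun _ _ => measure_ball_lt_top.ne), ← ENNReal.ofReal_sub _ (by positivity)]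

/-- **DYADIC LAYER BOUND (the log-sharp shell integral)**: there is an absolute `C > 0` with
`∫_{r ≤ |y| ≤ r+L} |x − y|⁻² dy ≤ C·L·(1 + log(r/L))` for all `0 < L ≤ r` and all `x` (near part `|x−y| < L`: `4πL`; dyadic
layers `2ʲL ≤ |x−y| < 2ʲ⁺¹L` below `r/8`: `96L` each by the slab volume lemma, `≤ 1 + 2log(r/L)` of them; the rest: `|x−y| ≥ r/8`
against the shell volume `≤ 7|B₁|Lr²`). [folklore] -/
theorem exists_lintegral_shell_powKer_two_le :
    ∃ C : ℝ, 0 < C ∧ ∀ r L : ℝ, 0 < L → L ≤ r → ∀ x : EuclideanSpace ℝ (Fin 3),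
      ∫⁻ y in {y : EuclideanSpace ℝ (Fin 3) | r ≤ ‖y‖ ∧ ‖y‖ ≤ r + L}, powKer 2 (x - y) ≤
        ENNReal.ofReal (C * L * (1 + Real.log (r / L))) := by
  classical
  obtain ⟨κ, hκ⟩ : ∃ κ : ℝ, κ = (∫⁻ u in Metric.ball (0 : EuclideanSpace ℝ (Fin 3)) 1, powKer 2 u).toReal := ⟨_, rfl⟩
  have hκ0 : 0 ≤ κ := by rw [hκ]; exact ENNReal.toReal_nonneg
  obtain ⟨c₃, hc₃⟩ : ∃ c₃ : ℝ, c₃ = (volume (Metric.ball (0 : EuclideanSpace ℝ (Fin 3)) 1)).toReal := ⟨_, rfl⟩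
  have hc₃0 : 0 ≤ c₃ := by rw [hc₃]; exact ENNReal.toReal_nonneg
  have hballc : volume (Metric.ball (0 : EuclideanSpace ℝ (Fin 3)) 1) = ENNReal.ofReal c₃ := by
    rw [hc₃, ENNReal.ofReal_toReal measure_ball_lt_top.ne]
  refine ⟨κ + 192 + 448 * c₃ + 1, by positivity, ?_⟩
  intro r L hL hLr x
  have hr : 0 < r := lt_of_lt_of_le hL hLr
  have hℓ : 0 ≤ Real.log (r / L) := Real.log_nonneg ((one_le_div hL).2 hLr)
  set A : Set (EuclideanSpace ℝ (Fin 3)) := {y | r ≤ ‖y‖ ∧ ‖y‖ ≤ r + L} with hA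
  have hAm : MeasurableSet A :=
    (measurableSet_le measurable_const continuous_norm.measurable).inter
      (measurableSet_le continuous_norm.measurable measurable_const)
  -- `N` minimal with `r/8 ≤ 2^N L`
  have hex : ∃ N : ℕ, r / 8 ≤ 2 ^ N * L := by
    obtain ⟨N, hN⟩ := pow_unbounded_of_one_lt (r / 8 / L) (one_lt_two (α := ℝ))
    exact ⟨N, by rw [div_lt_iff₀ hL] at hN; exact hN.le⟩
  obtain ⟨N, hN, hNmin⟩ : ∃ N : ℕ, r / 8 ≤ 2 ^ N * L ∧ ∀ j, j < N → 2 ^ j * L < r / 8 :=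
    ⟨Nat.find hex, Nat.find_spec hex, fun j hj => lt_of_not_ge (Nat.find_min hex hj)⟩
  have hNle : (N : ℝ) ≤ 1 + 2 * Real.log (r / L) := by
    rcases Nat.eq_zero_or_pos N with h0 | hpos
    · rw [h0]; simp only [Nat.cast_zero]; linarith
    · have h1 := hNmin (N - 1) (by omega)
      have h2 : (2 : ℝ) ^ (N - 1) < r / L := by rw [lt_div_iff₀ hL]; linarith
      have h3 : ((N - 1 : ℕ) : ℝ) * Real.log 2 < Real.log (r / L) := by
        rw [← Real.log_pow]; exact Real.log_lt_log (by positivity) h2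
      have h4 : ((N - 1 : ℕ) : ℝ) = N - 1 := by rw [Nat.cast_sub hpos, Nat.cast_one]
      rw [h4] at h3
      have hlog2 := Real.log_two_gt_d9
      have hN1 : (0 : ℝ) ≤ N - 1 := by
        have : (1 : ℝ) ≤ N := by exact_mod_cast hpos
        linarith
      nlinarith
  -- the three pieces of the majorant
  set f₁ : EuclideanSpace ℝ (Fin 3) → ℝ≥0∞ := (Metric.ball x L).indicator fun y => powKer 2 (x - y) with hf₁
  set cst : ℕ → ℝ≥0∞ := fun j => ENNReal.ofReal ((((2 : ℝ) ^ j * L) ^ 2)⁻¹) with hcst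
  set f₂ : EuclideanSpace ℝ (Fin 3) → ℝ≥0∞ :=
    fun y => ∑ j ∈ Finset.range N, (A ∩ Metric.ball x (2 ^ (j + 1) * L)).indicator (fun _ => cst j) y with hf₂
  have hpk : (fun y : EuclideanSpace ℝ (Fin 3) => powKer 2 (x - y)) = fun y => powKer 2 (y - x) :=
    funext fun y => powKer_sub_comm 2 x y
  have hf₁m : Measurable f₁ := by
    have : Measurable fun y : EuclideanSpace ℝ (Fin 3) => powKer 2 (x - y) := by
      rw [hpk]; exact measurable_powKer_sub 2 x
    exact this.indicator measurableSet_ball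
  have hf₂m : Measurable f₂ := by
    refine Finset.measurable_sum _ fun j _ => ?_
    exact measurable_const.indicator (hAm.inter measurableSet_ball)
  -- THE POINTWISE MAJORANT on `A`
  have hptw : ∀ y ∈ A, powKer 2 (x - y) ≤ f₁ y + f₂ y + ENNReal.ofReal (64 / r ^ 2) := by
    intro y hy
    by_cases hd : ‖x - y‖ < L
    · have hmem : y ∈ Metric.ball x L := by rw [mem_ball_iff_norm, norm_sub_rev]; exact hd
      have : f₁ y = powKer 2 (x - y) := by rw [hf₁, indicator_of_mem hmem]
      rw [this]
      exact le_add_right (le_add_right le_rfl)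
    push Not at hd
    by_cases hfar : 2 ^ N * L ≤ ‖x - y‖
    · -- the far region: `|x−y| ≥ r/8`
      have h8 : r / 8 ≤ ‖x - y‖ := hN.trans hfar
      have h1 : powKer 2 (x - y) ≤ ENNReal.ofReal ((r / 8) ^ (-(2 : ℝ))) := powKer_le_const (by norm_num) (by positivity) h8
      have h2 : (r / 8) ^ (-(2 : ℝ)) = 64 / r ^ 2 := by
        rw [Real.rpow_neg (by positivity), Real.rpow_two]; field_simp; norm_num
      rw [h2] at h1
      exact h1.trans le_add_self
    · push Not at hfar
      -- a dyadic layer `2^j L ≤ |x−y| < 2^{j+1} L`, `j < N`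
      have hexj : ∃ j : ℕ, ‖x - y‖ < 2 ^ (j + 1) * L := by
        have hN1 : 1 ≤ N := by
          by_contra h0
          push Not at h0
          have : N = 0 := by omega
          rw [this, pow_zero, one_mul] at hfar
          linarith
        exact ⟨N - 1, by rw [Nat.sub_add_cancel hN1]; exact hfar⟩
      obtain ⟨j, hj, hjmin⟩ : ∃ j : ℕ, ‖x - y‖ < 2 ^ (j + 1) * L ∧ ∀ i, i < j → ¬ (‖x - y‖ < 2 ^ (i + 1) * L) :=
        ⟨Nat.find hexj, Nat.find_spec hexj, fun i hi => Nat.find_min hexj hi⟩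
      have hjlow : 2 ^ j * L ≤ ‖x - y‖ := by
        rcases Nat.eq_zero_or_pos j with hj0 | hjpos
        · rw [hj0, pow_zero, one_mul]; exact hd
        · have := hjmin (j - 1) (by omega)
          rw [Nat.sub_add_cancel hjpos] at this
          exact le_of_not_gt this
      have hjN : j < N := by
        by_contra hcon
        push Not at hcon
        have h1 : (2 : ℝ) ^ N * L ≤ 2 ^ j * L :=
          mul_le_mul_of_nonneg_right (pow_le_pow_right₀ (by norm_num) hcon) hL.le
        linarith
      have hpos : 0 < (2 : ℝ) ^ j * L := by positivity
      have h1 : powKer 2 (x - y) ≤ cst j := by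
        have := powKer_le_const (s := 2) (by norm_num) hpos hjlow
        rw [hcst]
        refine this.trans (le_of_eq ?_)
        rw [Real.rpow_neg hpos.le, Real.rpow_two]
      have hmem : y ∈ A ∩ Metric.ball x (2 ^ (j + 1) * L) :=
        ⟨hy, by rw [mem_ball_iff_norm, norm_sub_rev]; exact hj⟩
      have h2 : cst j ≤ f₂ y := by
        rw [hf₂]
        have := Finset.single_le_sum (f := fun i => (A ∩ Metric.ball x (2 ^ (i + 1) * L)).indicator (fun _ => cst i) y)
          (fun i _ => zero_le) (Finset.mem_range.2 hjN)
        simp only [indicator_of_mem hmem] at this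
        exact this
      exact (h1.trans h2).trans (le_add_left le_rfl) |>.trans (le_add_right le_rfl)
  -- INTEGRATE the majorant over `A`
  have hI₁ : ∫⁻ y in A, f₁ y ≤ ENNReal.ofReal (L * κ) := by
    refine (setLIntegral_le_lintegral _ _).trans ?_
    have h1 : ∫⁻ y, f₁ y = ∫⁻ y, (Metric.ball (0 : EuclideanSpace ℝ (Fin 3)) L).indicator (powKer 2) (x - y) := by
      refine lintegral_congr fun y => ?_
      rw [hf₁]
      by_cases hmem : y ∈ Metric.ball x L
      · have hmem' : x - y ∈ Metric.ball (0 : EuclideanSpace ℝ (Fin 3)) L := by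
          rw [mem_ball_zero_iff, norm_sub_rev]; rwa [mem_ball_iff_norm] at hmem
        rw [indicator_of_mem hmem, indicator_of_mem hmem']
      · have hmem' : x - y ∉ Metric.ball (0 : EuclideanSpace ℝ (Fin 3)) L := by
          rw [mem_ball_zero_iff, norm_sub_rev]; rwa [mem_ball_iff_norm] at hmem
        rw [indicator_of_notMem hmem, indicator_of_notMem hmem']
    rw [h1, lintegral_sub_left_eq_self (fun z => (Metric.ball (0 : EuclideanSpace ℝ (Fin 3)) L).indicator (powKer 2) z) x,
      lintegral_indicator measurableSet_ball, Literature.Analysis.Potential.setLIntegral_ball_powKer_two hL, ← hκ]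
  have hI₂ : ∫⁻ y in A, f₂ y ≤ ENNReal.ofReal (N * (96 * L)) := by
    refine (setLIntegral_le_lintegral _ _).trans ?_
    rw [hf₂, lintegral_finsetSum _ (fun j _ => measurable_const.indicator (hAm.inter measurableSet_ball))]
    have hterm : ∀ j ∈ Finset.range N,
        ∫⁻ y, (A ∩ Metric.ball x (2 ^ (j + 1) * L)).indicator (fun _ => cst j) y ≤ ENNReal.ofReal (96 * L) := by
      intro j hj
      have hjN := Finset.mem_range.1 hj
      rw [lintegral_indicator_const (hAm.inter measurableSet_ball)]
      have hρ : 0 < (2 : ℝ) ^ (j + 1) * L := by positivity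
      have hρr : 4 * (2 ^ (j + 1) * L) ≤ r := by
        have := hNmin j hjN; rw [pow_succ]; linarith
      have hvol := volume_shell_inter_ball_le hr hL hρ hρr x
      calc cst j * volume (A ∩ Metric.ball x (2 ^ (j + 1) * L))
          ≤ cst j * ENNReal.ofReal (24 * L * (2 ^ (j + 1) * L) ^ 2) := mul_le_mul' le_rfl hvol
        _ = ENNReal.ofReal (96 * L) := by
            rw [hcst, ← ENNReal.ofReal_mul (by positivity)]
            congr 1
            have : (2 : ℝ) ^ j * L ≠ 0 := by positivity
            field_simp
            ring
    calc ∑ j ∈ Finset.range N, ∫⁻ y, (A ∩ Metric.ball x (2 ^ (j + 1) * L)).indicator (fun _ => cst j) y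
        ≤ ∑ j ∈ Finset.range N, ENNReal.ofReal (96 * L) := Finset.sum_le_sum hterm
      _ = ENNReal.ofReal (N * (96 * L)) := by
          rw [Finset.sum_const, Finset.card_range, nsmul_eq_mul, ENNReal.ofReal_mul (p := (N : ℝ)) N.cast_nonneg,
            ENNReal.ofReal_natCast]
  have hI₃ : ∫⁻ _ in A, ENNReal.ofReal (64 / r ^ 2) ≤ ENNReal.ofReal (448 * c₃ * L) := by
    rw [setLIntegral_const]
    have hvolA := volume_shell_le hr hL
    have hshell : (r + L) ^ 3 - r ^ 3 ≤ 7 * L * r ^ 2 := by nlinarith [mul_pos hL hr, sq_nonneg L]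
    calc ENNReal.ofReal (64 / r ^ 2) * volume A
        ≤ ENNReal.ofReal (64 / r ^ 2) * (ENNReal.ofReal ((r + L) ^ 3 - r ^ 3) * ENNReal.ofReal c₃) := by
          rw [← hballc]; exact mul_le_mul' le_rfl hvolA
      _ ≤ ENNReal.ofReal (64 / r ^ 2) * (ENNReal.ofReal (7 * L * r ^ 2) * ENNReal.ofReal c₃) := by
          gcongr
      _ = ENNReal.ofReal (448 * c₃ * L) := by
          rw [← ENNReal.ofReal_mul (by positivity), ← ENNReal.ofReal_mul (by positivity)]
          congr 1
          field_simp
          ring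
  -- assemble
  have hfin : L * κ + N * (96 * L) + 448 * c₃ * L ≤ (κ + 192 + 448 * c₃ + 1) * L * (1 + Real.log (r / L)) := by
    have h1 : (N : ℝ) * (96 * L) ≤ (1 + 2 * Real.log (r / L)) * (96 * L) :=
      mul_le_mul_of_nonneg_right hNle (by positivity)
    have h2 : 0 ≤ L * Real.log (r / L) := mul_nonneg hL.le hℓ
    have h3 : 0 ≤ κ * (L * Real.log (r / L)) := mul_nonneg hκ0 h2
    have h4 : 0 ≤ c₃ * (L * Real.log (r / L)) := mul_nonneg hc₃0 h2
    have e : (κ + 192 + 448 * c₃ + 1) * L * (1 + Real.log (r / L)) =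
        L * κ + κ * (L * Real.log (r / L)) + (192 * L + 192 * (L * Real.log (r / L))) +
          (448 * c₃ * L + 448 * (c₃ * (L * Real.log (r / L)))) + (L + L * Real.log (r / L)) := by ring
    rw [e]
    nlinarith
  calc ∫⁻ y in A, powKer 2 (x - y)
      ≤ ∫⁻ y in A, (f₁ y + f₂ y + ENNReal.ofReal (64 / r ^ 2)) := setLIntegral_mono' hAm hptw
    _ = (∫⁻ y in A, f₁ y) + (∫⁻ y in A, f₂ y) + ∫⁻ _ in A, ENNReal.ofReal (64 / r ^ 2) := by
        rw [lintegral_add_right _ measurable_const, lintegral_add_left hf₁m]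
    _ ≤ ENNReal.ofReal (L * κ) + ENNReal.ofReal (N * (96 * L)) + ENNReal.ofReal (448 * c₃ * L) :=
        add_le_add (add_le_add hI₁ hI₂) hI₃
    _ = ENNReal.ofReal (L * κ + N * (96 * L) + 448 * c₃ * L) := by
        rw [← ENNReal.ofReal_add (by positivity) (by positivity), ← ENNReal.ofReal_add (by positivity) (by positivity)]
    _ ≤ ENNReal.ofReal ((κ + 192 + 448 * c₃ + 1) * L * (1 + Real.log (r / L))) := ENNReal.ofReal_le_ofReal hfin

end Summit.NavierStokesRegularity.NavierStokesRegularity.Cruxes.TypeIQuantSubcubicExp.QuietCollar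

end
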